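import Literature.IUT.LogVolume.TameQuadraticCoordinates
import Literature.IUT.LogVolume.IsometryGaloisOrder
import Mathlib.FieldTheory.Galois.Basic
import Mathlib.RingTheory.Trace.Basic
import HarnessLib

/-!
# The tame quadratic field `K = ℚ_p(π)`, `π² = p`, `p` odd: a NORM-UNIMODULAR trace-dual pair, hence every isometry is a unit of `𝒪_K⟨Gal⟩`

abc-iut cell, seat abc-iut-E-t42 (gen 4; rung LADDER-ABC:A2.RESCUE.J, R-J row Y-29b).  PROOF-ONLY classical local arithmetic; no definition,
no `Prop` fact, no `sorry`.  Sequel of `IsometryGaloisOrder.lean` (the Dedekind-coefficient criterion, whose hypothesis — a trace-dual pair of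
`ℚ_p`-bases `(b, d)` with `‖b_m‖·‖d_m‖ ≤ 1` — is discharged HERE at the first tame rung) over abc-iut-E-t14's `TameQuadraticCoordinates.lean`
(basis `(1, π)`, `‖2‖ = 1`, `‖π‖² = 1/p`).

* `trace_pi` — `Tr_{K/ℚ_p}(π) = 0` (`[K : ℚ_p] = 2`, `π² = p`; matrix of `π` in the basis `(1, π)`); `trace_natCast_smul_one` — `Tr(r·1) = 2r`;
* `isGalois` — a quadratic extension of `ℚ_p` is Galois (Mathlib `IsQuadraticExtension.isGalois`, separability in characteristic `0`);
* **`exists_normUnimodular_dualPair`** — `p` odd: `b = (1, π)`, `d = (1/2, π/(2p))` is a trace-dual pair with `‖b_i‖·‖d_i‖ = 1`;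
* **`exists_galoisOrder_repr_of_isometry`** — hence EVERY `ℚ_p`-linear isometry `g` of `K` has `g`, `g⁻¹ ∈ 𝒪_K⟨Gal(K/ℚ_p)⟩` with integral
  coefficients: the `hIsmG` shape of the cell's `Summit.ABC.IUTFork.Joshi.PinsGaloisOrder` (p460152) holds for ALL isometries at such `K` —
  complementary to abc-iut-E-t14's `TameQuadraticIsometryStable.congr_image_normalizedPacket_eq_of_isometry` (stability of `(R_I)^∼` of the
  two-slot packet `K ⊗ K` by saturation); this form feeds packets of every shape and slot count.

Nothing here is disputed mathematics; the consumer rows are the cell's typings [claim: Mochizuki2012, status: disputed] of (Ind2).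
[cite: NeukirchANT1999, Ch. II (5.5)] [cite: SerreLocalFields1979, Ch. III §3]
-/

noncomputable section

open Module

namespace Literature.IUT.LogVolume

namespace TameQuadratic

variable {p : ℕ} [Fact p.Prime] {K : Type} [NontriviallyNormedField K] [NormedAlgebra ℚ_[p] K] {π : K}

/-- **`Tr_{K/ℚ_p}(π) = 0`** for `[K : ℚ_p] = 2`, `π² = p`: in the basis `(1, π)` multiplication by `π` has matrix `[[0, p], [1, 0]]`.
[cite: NeukirchANT1999, Ch. II (5.5)] -/
theorem trace_pi [IsUltrametricDist K] (hK : finrank ℚ_[p] K = 2) (hπ : π ^ 2 = (p : K)) : Algebra.trace ℚ_[p] K π = 0 := by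
  classical
  obtain ⟨B, hB0, hB1⟩ := exists_basis hK hπ
  obtain ⟨_, h11, hπ0, _⟩ := repr_one_pi B hB0 hB1
  have hp' : (p : K) = (p : ℚ_[p]) • (1 : K) := by rw [← map_natCast (algebraMap ℚ_[p] K) p, Algebra.algebraMap_eq_smul_one]
  rw [Algebra.trace_eq_matrix_trace B, Matrix.trace, Fin.sum_univ_two, Matrix.diag_apply, Matrix.diag_apply,
    Algebra.leftMulMatrix_eq_repr_mul, Algebra.leftMulMatrix_eq_repr_mul, hB0, hB1, mul_one, ← sq, hπ, hπ0, hp', map_smul,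
    Finsupp.smul_apply, h11, smul_zero, zero_add]

/-- **`Tr_{K/ℚ_p}(1) = 2`, `Tr_{K/ℚ_p}(p) = 2p`** (`[K : ℚ_p] = 2`). [cite: NeukirchANT1999, Ch. II (5.5)] -/
theorem trace_natCast_smul_one (hK : finrank ℚ_[p] K = 2) (r : ℚ_[p]) : Algebra.trace ℚ_[p] K (r • (1 : K)) = 2 * r := by
  rw [← Algebra.algebraMap_eq_smul_one, Algebra.trace_algebraMap, hK, nsmul_eq_mul, Nat.cast_ofNat]

/-- **A quadratic extension of `ℚ_p` is Galois** (separable in characteristic `0`; Mathlib `IsQuadraticExtension.isGalois`).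
[cite: NeukirchANT1999, Ch. II (5.5)] -/
theorem isGalois (hK : finrank ℚ_[p] K = 2) : IsGalois ℚ_[p] K := by
  haveI : FiniteDimensional ℚ_[p] K := Module.finite_of_finrank_eq_succ hK
  haveI : Algebra.IsQuadraticExtension ℚ_[p] K := ⟨hK⟩
  infer_instance

/-- **THE NORM-UNIMODULAR TRACE-DUAL PAIR OF A TAME QUADRATIC FIELD**: for `p` odd, `[K : ℚ_p] = 2`, `π² = p`, the bases `b = (1, π)` and
`d = (1/2, π/(2p)) = (1/2, 1/(2π))` satisfy `Tr(d_i b_j) = δ_{ij}` and `‖b_i‖·‖d_i‖ = 1` (`‖2‖ = 1`, `‖π‖² = 1/p`) — the hypothesis of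
`exists_galoisOrder_repr_of_isometry` (`IsometryGaloisOrder.lean`): at such `K` every `ℚ_p`-linear ISOMETRY is a unit of `𝒪_K⟨Gal(K/ℚ_p)⟩`.
[cite: NeukirchANT1999, Ch. II (5.5)] [cite: SerreLocalFields1979, Ch. III §3] -/
theorem exists_normUnimodular_dualPair [IsUltrametricDist K] (hp : p ≠ 2) (hK : finrank ℚ_[p] K = 2) (hπ : π ^ 2 = (p : K)) :
    ∃ b d : Basis (Fin 2) ℚ_[p] K,
      (∀ i j, Algebra.trace ℚ_[p] K (d i * b j) = if j = i then 1 else 0) ∧ ∀ i, ‖b i‖ * ‖d i‖ ≤ 1 := by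
  obtain ⟨B, hB0, hB1⟩ := exists_basis hK hπ
  have hp0 : (p : ℚ_[p]) ≠ 0 := by exact_mod_cast (Fact.out : p.Prime).ne_zero
  have h20 : (2 : ℚ_[p]) ≠ 0 := two_ne_zero
  have h2 : ‖(2 : ℚ_[p])‖ = 1 := by
    have h := norm_two p hp (K := ℚ_[p])
    exact h
  -- the scalars `w₀ = 1/2`, `w₁ = 1/(2p)`
  let w : Fin 2 → ℚ_[p]ˣ := ![Units.mk0 (2 : ℚ_[p])⁻¹ (inv_ne_zero h20), Units.mk0 (2 * (p : ℚ_[p]))⁻¹ (inv_ne_zero (mul_ne_zero h20 hp0))]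
  have hw0 : ((w 0 : ℚ_[p]ˣ) : ℚ_[p]) = (2 : ℚ_[p])⁻¹ := rfl
  have hw1 : ((w 1 : ℚ_[p]ˣ) : ℚ_[p]) = (2 * (p : ℚ_[p]))⁻¹ := rfl
  have hππ : π * π = (p : ℚ_[p]) • (1 : K) := by
    rw [← sq, hπ, ← map_natCast (algebraMap ℚ_[p] K) p, Algebra.algebraMap_eq_smul_one]
  have htr : ∀ i j, Algebra.trace ℚ_[p] K (B.unitsSMul w i * B j) = ((w i : ℚ_[p]ˣ) : ℚ_[p]) * Algebra.trace ℚ_[p] K (B i * B j) :=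
    fun i j => by rw [Basis.unitsSMul_apply, Units.smul_def, smul_mul_assoc, map_smul, smul_eq_mul]
  have hnm : ∀ i, ‖B i‖ * ‖B.unitsSMul w i‖ = ‖B i‖ * (‖((w i : ℚ_[p]ˣ) : ℚ_[p])‖ * ‖B i‖) := fun i => by
    rw [Basis.unitsSMul_apply, Units.smul_def, norm_smul]
  refine ⟨B, B.unitsSMul w, Fin.forall_fin_two.mpr ⟨Fin.forall_fin_two.mpr ⟨?_, ?_⟩, Fin.forall_fin_two.mpr ⟨?_, ?_⟩⟩,
    Fin.forall_fin_two.mpr ⟨?_, ?_⟩⟩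
  · rw [htr, if_pos rfl, hw0, hB0, mul_one, show (1 : K) = (1 : ℚ_[p]) • (1 : K) by rw [one_smul],
      trace_natCast_smul_one hK, mul_one, inv_mul_cancel₀ h20]
  · rw [htr, if_neg Fin.zero_ne_one.symm, hB0, hB1, one_mul, trace_pi hK hπ, mul_zero]
  · rw [htr, if_neg Fin.zero_ne_one, hB0, hB1, mul_one, trace_pi hK hπ, mul_zero]
  · rw [htr, if_pos rfl, hw1, hB1, hππ, trace_natCast_smul_one hK, inv_mul_cancel₀ (mul_ne_zero h20 hp0)]
  · rw [hnm, hw0, hB0, norm_one, one_mul, mul_one, norm_inv, h2, inv_one]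
  · rw [hnm, hw1, hB1, norm_inv, norm_mul, h2, one_mul, Padic.norm_p, inv_inv, ← mul_assoc, mul_comm, ← mul_assoc, ← sq,
      norm_pi_sq hπ, inv_mul_cancel₀ (by exact_mod_cast (Fact.out : p.Prime).ne_zero : (p : ℝ) ≠ 0)]

/-- **Every `ℚ_p`-linear ISOMETRY of a tame quadratic `K` (`p` odd, `[K : ℚ_p] = 2`, `π² = p`) is a UNIT OF THE INTEGRAL GALOIS ORDER
`𝒪_K⟨Gal(K/ℚ_p)⟩`**: `g` and `g⁻¹` are `Σ_σ c_σ·σ` with `‖c_σ‖ ≤ 1` — the `hIsmG` shape of the cell's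
`Summit.ABC.IUTFork.Joshi.PinsGaloisOrder.exists_pinnedRegions_honestSetting_of_galoisOrderIsm` (p460152), here for ALL isometries (contrast:
`TameQuadraticIsometryStable.congr_image_normalizedPacket_eq_of_isometry` proves the stability of `(R_I)^∼` of `K ⊗ K` directly; this
form feeds packets of every shape). [cite: SerreLocalFields1979, Ch. III §3] [cite: NeukirchANT1999, Ch. II (5.5)] -/
theorem exists_galoisOrder_repr_of_isometry [IsUltrametricDist K] [ProperSpace K] (hp : p ≠ 2) (hK : finrank ℚ_[p] K = 2)
    (hπ : π ^ 2 = (p : K)) (g : K ≃ₗ[ℚ_[p]] K) (hg : ∀ x, ‖g x‖ = ‖x‖) :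
    (∃ (T : Finset (K ≃ₐ[ℚ_[p]] K)) (c : (K ≃ₐ[ℚ_[p]] K) → K), (∀ τ ∈ T, ‖c τ‖ ≤ 1) ∧ ∀ x, g x = ∑ τ ∈ T, c τ * τ x) ∧
    (∃ (T : Finset (K ≃ₐ[ℚ_[p]] K)) (c : (K ≃ₐ[ℚ_[p]] K) → K), (∀ τ ∈ T, ‖c τ‖ ≤ 1) ∧ ∀ x, g.symm x = ∑ τ ∈ T, c τ * τ x) := by
  haveI : FiniteDimensional ℚ_[p] K := Module.finite_of_finrank_eq_succ hK
  haveI := isGalois hK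
  obtain ⟨b, d, hbd, hnorm⟩ := exists_normUnimodular_dualPair hp hK hπ
  exact Literature.IUT.LogVolume.exists_galoisOrder_repr_of_isometry b d hbd hnorm g hg

end TameQuadratic

end Literature.IUT.LogVolume

end
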